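import Literature.Dynamics.IntervalMaps.IntervalCoveringPeriodicPoints
import HarnessLib

/-!
# Sharkovsky forcing, the three steps (a), (b), (c) of Du's proof: a period `m ≥ 3` forces period `2`; an odd period
# `m ≥ 3` forces period `m + 2` and every even period (Du 2004/2007, §3)

Foundations-library file (lane `lit-hodgefound`, prover p24 gen 81; one-dimensional dynamics series, file 3 of the
Sharkovsky package).  THEOREMS ONLY: no definition, no named fact, net debt 0.  Setting as in file 1: `f : ℝ → ℝ`
continuous on a compact interval `[A, B]` which it maps into itself (Du: «`I` is a compact interval, and `f : I → I`
is a continuous map»); least periods are Mathlib's `Function.minimalPeriod`.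

## Source, VERBATIM

B.-S. Du, *A collection of simple proofs of Sharkovsky's theorem*, arXiv:math/0703592 [Du2007SharkovskyCollection]
(held `paper:arxiv-math_0703592`, p0002 and p0004–p0005; §3 is the proof of B.-S. Du, *A simple proof of Sharkovsky's
theorem revisited*, Amer. Math. Monthly 114 (2007) 152–155, and a variant of [Du2004SharkovskySimpleProof]):
«It is well-known [du2, du3, str] that (1) is equivalent to the following three statements: (a) if `f` has a
period-`m` point with `m ≥ 3`, then `f` has a period-`2` point; (b) if `f` has a period-`m` point with `m ≥ 3` and
odd, then `f` has a period-`(m+2)` point; and (c) if `f` has a period-`m` point with `m ≥ 3` and odd, then `f` has a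
period-`6` point and a period-`(2m)` point. … **3 A non-directed graph proof of (a), (b) and (c)** … Let `P` be a
period-`m` orbit of `f` with `m ≥ 3`. Let `v` be a point such that `min P ≤ f²(v) < v < f(v) = b ∈ P`. Let `z` be a
fixed point of `f` in `[v, b]`. Since `f²(min P) > min P` and `f²(v) < v`, the point `y = max{min P ≤ x ≤ v : f²(x) = x}`
exists. Furthermore, `f(x) > z` on `[y, v]` and `f²(x) < x` on `(y, v]`. Therefore, `y` is a period-`2` point of `f`.
(a) is proved.  For the proofs of (b) and (c), assume that `m ≥ 3` is odd and note that `f(x) > z > x > f²(x)` on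
`(y, v]`. Since `f^{m+2}(y) = f(y) > y` and `f^{m+2}(v) = f²(v) = f(b) < v`, the point
`p_{m+2} = min{y ≤ x ≤ v : f^{m+2}(x) = x}` exists. Let `k` denote the least period of `p_{m+2}` with respect to `f`.
Then `k` divides `m+2` and so `k` is odd. Furthermore, `k > 1` because `f` has no fixed points in `(y, v)`. If `k < m+2`,
let `x_k = p_{m+2}`, then `x_k` is a solution of the equation `f^k(x) = x` in `(y, v)`. Since `f^{k+2}(y) = f(y) > y` and
`f^{k+2}(x_k) = f²(f^k(x_k)) = f²(x_k) < x_k`, the equation `f^{k+2}(x) = x` has a solution `x_{k+2}` in `(y, x_k)`.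
Inductively, for each `n ≥ 1`, the equation `f^{k+2n}(x) = x` has a solution `x_{k+2n}` such that
`y < ⋯ < x_{k+4} < x_{k+2} < x_k < v`. Consequently, the equation `f^{m+2}(x) = x` has a solution `x_{m+2}` such that
`y < x_{m+2} < x_k = p_{m+2}`. This contradicts the minimality of `p_{m+2}`. So, `p_{m+2}` is a period-`(m+2)` point of
`f`. This proves (b).  We now prove (c). Let `z₀ = min{x : v ≤ x ≤ z, f²(x) = x}`. Then `f²(x) < x` and `f(x) > z` when
`y < x < z₀`. If `f²(x) < z₀` whenever `min I ≤ x < z₀`, then `f²([min I, z₀]) ⊂ [min I, z₀]`, which contradicts the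
fact that `(f²)^{(m+1)/2}(v) = b > z₀`. So, the point `d = max{x : min I ≤ x ≤ y, f²(x) = z₀}` exists and
`f(x) > z ≥ z₀ > f²(x)` for all `x` in `(d, y)`. Therefore `f(x) > z ≥ z₀ > f²(x)` whenever `d < x < z₀`. Let
`s = min{f²(x) : d ≤ x ≤ z₀}`. If `s ≥ d`, then `f²([d, z₀]) ⊂ [d, z₀]`, which again contradicts the fact that
`(f²)^{(m+1)/2}(v) = b > z₀`. Thus `s < d`. Let `u = min{d ≤ x ≤ z₀ : f²(x) = d}`. … So, each `c_{2n}` is a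
period-`(2n)` point of `f`. Therefore, `f` has periodic points of all even periods. This establishes (c).  Remarks. (1)
In the proof of (a), there are many ways to choose such point `v`. One is: Let `a = max{x ∈ P : f(x) > x}` and
`b = min{x ∈ P : a < x}`. Then `f(b) ≤ a < b ≤ f(a)`. We can choose `v` to be a point in `[a, b]` such that `f(v) = b`.»

## What is formalized (all PROVED), and the one deviation from the printed road

* §1 plumbing: IVT fixed points from a sign change, compact fixed/level loci in `[p, q]`, parity of iterates at a
  period-`2` point (all private).
* §2 **`exists_du_configuration`** — Remark (1): from a period-`m` orbit `P ⊂ [A, B]`, `m ≥ 3`, the points `v` and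
  `min P` with `min P ≤ f²(v) < v < f(v) = b ∈ P`, `f^m(b) = b`, `f²(min P) > min P`.
* §3 **`exists_period_two_point`** (the construction of `z` and `y = max{min P ≤ x ≤ v : f²(x) = x}` with
  «`f(x) > z` on `[y, v]` and `f²(x) < x` on `(y, v]`») and **(a) `exists_minimalPeriod_two_of_minimalPeriod_ge_three`**.
* §4 **(b) `exists_minimalPeriod_add_two_of_odd`**: `p_{m+2} = min{y ≤ x ≤ v : f^{m+2}(x) = x}` and the descent
  `x_k > x_{k+2} > ⋯ > x_{m+2}`.
* §5 **(c) `exists_minimalPeriod_two_mul_of_odd`** (its data isolated as `exists_sq_horseshoe_of_odd` for reuse):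
  `z₀`, the escape of `(f²)^{(m+1)/2}(v) = b > z₀` from `[min I, z₀]`
  and from `[d, z₀]`, the points `d` and `u` (`f²(d) = z₀`, `f²(u) = d`, `f²(z₀) = z₀`, `f > z ≥ z₀ > f²` on `(d, z₀)`).
  DEVIATION (shorter road, same ingredients): instead of Du's nested minima `c₂ > c₄ > ⋯` we finish with file 1's
  cycle lemma applied to `f²` and the two intervals `K₀ = [d, u]`, `K₁ = [u, z₀]`, each of which `f²`-covers `[d, z₀]`
  (`exists_periodicPt_itinerary_two` + `minimalPeriod_eq_of_itinerary`; `u ↦ d ↦ z₀ ↦ z₀` is not periodic), which gives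
  a point `c` of least `f²`-period `n` whose `f²`-orbit lies in `(d, z₀)`; as in Du's last lines, the odd iterates
  `f^{2i+1}(c) > z ≥ z₀` then show that the least `f`-period of `c` is exactly `2n`
  (`exists_minimalPeriod_two_mul_of_horseshoe`).

NOT formalized here: the assembly of (a), (b), (c) into the Sharkovsky forcing theorem (Du §13) — next file of the
series.  Tree search (FAIL-DUP, 2026-09-01): nothing on periods of interval maps in Mathlib or `Literature/` besides
files 1–2 of this series.
-/

noncomputable section

open Set Function

namespace Literature.Dynamics.IntervalMaps

variable {f : ℝ → ℝ} {A B : ℝ}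

/-! ## §1 Plumbing: sign-change fixed points, compact loci, parity of iterates -/

/-- IVT: `p ≤ g(p)` and `g(q) ≤ q` give a fixed point of `g` in `[p, q]`. [folklore] -/
private theorem exists_fixedPt_of_le_of_ge {g : ℝ → ℝ} {p q : ℝ} (hpq : p ≤ q) (hg : ContinuousOn g (Icc p q))
    (hp : p ≤ g p) (hq : g q ≤ q) : ∃ w ∈ Icc p q, g w = w := by
  have hcont : ContinuousOn (fun x => g x - x) (Icc p q) := hg.sub continuousOn_id
  obtain ⟨w, hw, hw0⟩ := intermediate_value_Icc' hpq hcont ⟨sub_nonpos.2 hq, sub_nonneg.2 hp⟩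
  exact ⟨w, hw, sub_eq_zero.1 hw0⟩

/-- IVT: `g(p) ≤ p` and `q ≤ g(q)` give a fixed point of `g` in `[p, q]`. [folklore] -/
private theorem exists_fixedPt_of_ge_of_le {g : ℝ → ℝ} {p q : ℝ} (hpq : p ≤ q) (hg : ContinuousOn g (Icc p q))
    (hp : g p ≤ p) (hq : q ≤ g q) : ∃ w ∈ Icc p q, g w = w := by
  have hcont : ContinuousOn (fun x => g x - x) (Icc p q) := hg.sub continuousOn_id
  obtain ⟨w, hw, hw0⟩ := intermediate_value_Icc hpq hcont ⟨sub_nonpos.2 hp, sub_nonneg.2 hq⟩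
  exact ⟨w, hw, sub_eq_zero.1 hw0⟩

/-- The locus `{x ∈ [p, q] : g x = h x}` of two functions continuous on `[p, q]` is compact. [folklore] -/
private theorem isCompact_eqLocus {g h : ℝ → ℝ} {p q : ℝ} (hg : ContinuousOn g (Icc p q))
    (hh : ContinuousOn h (Icc p q)) : IsCompact {x | x ∈ Icc p q ∧ g x = h x} := by
  have hset : {x | x ∈ Icc p q ∧ g x = h x} = Icc p q ∩ (fun x => g x - h x) ⁻¹' {0} := by
    ext x; simp [sub_eq_zero]
  rw [hset]
  exact isCompact_Icc.of_isClosed_subset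
    ((hg.sub hh).preimage_isClosed_of_isClosed isClosed_Icc isClosed_singleton) inter_subset_left

/-- At a point with `f²(y) = y`, even iterates return to `y` and odd iterates to `f(y)`. [folklore] -/
private theorem iterate_two_mul_of_ff {y : ℝ} (hy : f (f y) = y) (t : ℕ) : f^[2 * t] y = y := by
  induction t with
  | zero => simp
  | succ t ih => rw [Nat.mul_succ, iterate_add_apply, show f^[2] y = y from hy, ih]

/-- Odd iterates at a point with `f²(y) = y` equal `f(y)`. [folklore] -/
private theorem iterate_two_mul_add_one_of_ff {y : ℝ} (hy : f (f y) = y) (t : ℕ) : f^[2 * t + 1] y = f y := by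
  rw [iterate_succ_apply', iterate_two_mul_of_ff hy]

/-- An `f²`-invariant compact interval confines the whole `f²`-orbit. [folklore] -/
private theorem iterate_ff_mem_of_mapsTo {p q v : ℝ} (hinv : MapsTo (fun x => f (f x)) (Icc p q) (Icc p q))
    (hv : v ∈ Icc p q) (t : ℕ) : f^[2 * t] v ∈ Icc p q := by
  have := hinv.iterate t hv
  rwa [show (fun x => f (f x))^[t] v = f^[2 * t] v from by
    rw [iterate_mul]; rfl] at this

/-! ## §2 The configuration `min P ≤ f²(v) < v < f(v) = b ∈ P` (Du's Remark (1)) -/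

/-- **Du's Remark (1).** Let `P` be a period-`m` orbit (`m ≥ 3`) of a continuous self-map `f` of `[A, B]`. With
`a = max{x ∈ P : f(x) > x}` and `b = min{x ∈ P : a < x}` one has `f(b) ≤ a < b ≤ f(a)`; a point `v ∈ [a, b]` with
`f(v) = b` then satisfies `min P ≤ f²(v) < v < f(v) = b ∈ P` (so `f^m(f(v)) = f(v)`), and `f²(min P) > min P`.
[cite: Du2007SharkovskyCollection, §3 Remark (1)] -/
theorem exists_du_configuration (hf : ContinuousOn f (Icc A B)) (hmaps : MapsTo f (Icc A B) (Icc A B)) {x₀ : ℝ}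
    (hx₀ : x₀ ∈ Icc A B) {m : ℕ} (hm : 3 ≤ m) (hper : minimalPeriod f x₀ = m) :
    ∃ v pm, v ∈ Icc A B ∧ pm ∈ Icc A B ∧ f (f v) < v ∧ v < f v ∧ f^[m] (f v) = f v ∧
      pm ≤ f (f v) ∧ pm < f (f pm) := by
  classical
  -- the orbit `P`
  set P : Finset ℝ := (Finset.range m).image fun i => f^[i] x₀ with hP
  have hx₀per : x₀ ∈ periodicPts f := minimalPeriod_pos_iff_mem_periodicPts.1 (by omega)
  have hmemP : ∀ {p}, p ∈ P ↔ ∃ i < m, f^[i] x₀ = p := by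
    intro p; simp [hP, Finset.mem_image, Finset.mem_range]
  have hPab : ∀ p ∈ P, p ∈ Icc A B := by
    intro p hp; obtain ⟨i, -, rfl⟩ := hmemP.1 hp; exact hmaps.iterate i hx₀
  have hPper : ∀ p ∈ P, minimalPeriod f p = m := by
    intro p hp; obtain ⟨i, -, rfl⟩ := hmemP.1 hp; rw [minimalPeriod_apply_iterate hx₀per, hper]
  have hPf : ∀ p ∈ P, f p ∈ P := by
    intro p hp; obtain ⟨i, hi, rfl⟩ := hmemP.1 hp
    rcases Nat.lt_or_ge (i + 1) m with hi1 | hi1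
    · exact hmemP.2 ⟨i + 1, hi1, by rw [iterate_succ_apply']⟩
    · refine hmemP.2 ⟨0, by omega, ?_⟩
      have : i + 1 = m := by omega
      have h1 : f (f^[i] x₀) = f^[m] x₀ := by rw [← this, iterate_succ_apply']
      rw [h1, ← hper, iterate_minimalPeriod, iterate_zero_apply]
  have hPfix : ∀ p ∈ P, f p ≠ p ∧ f (f p) ≠ p := by
    intro p hp
    constructor
    · intro h
      have := (IsFixedPt.isPeriodicPt (n := 1) h).minimalPeriod_le one_pos
      rw [hPper p hp] at this; omega
    · intro h
      have := (show IsPeriodicPt f 2 p from h).minimalPeriod_le two_pos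
      rw [hPper p hp] at this; omega
  have hPne : P.Nonempty := ⟨x₀, hmemP.2 ⟨0, by omega, rfl⟩⟩
  -- `min P`
  set pm := P.min' hPne with hpm
  have hpmP : pm ∈ P := Finset.min'_mem _ _
  have hpmle : ∀ p ∈ P, pm ≤ p := fun p hp => Finset.min'_le _ _ hp
  -- `a = max {x ∈ P : x < f x}`
  set S₁ := P.filter fun x => x < f x with hS₁
  have hS₁ne : S₁.Nonempty :=
    ⟨pm, Finset.mem_filter.2 ⟨hpmP, lt_of_le_of_ne (hpmle _ (hPf _ hpmP)) (hPfix _ hpmP).1.symm⟩⟩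
  set a := S₁.max' hS₁ne with ha
  have haS : a ∈ S₁ := Finset.max'_mem _ _
  have haP : a ∈ P := (Finset.mem_filter.1 haS).1
  have hafa : a < f a := (Finset.mem_filter.1 haS).2
  have hamax : ∀ p ∈ P, p < f p → p ≤ a := fun p hp h => Finset.le_max' _ _ (Finset.mem_filter.2 ⟨hp, h⟩)
  -- `b = min {x ∈ P : a < x}`
  set S₂ := P.filter fun x => a < x with hS₂
  have hS₂ne : S₂.Nonempty := ⟨f a, Finset.mem_filter.2 ⟨hPf _ haP, hafa⟩⟩
  set b := S₂.min' hS₂ne with hb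
  have hbS : b ∈ S₂ := Finset.min'_mem _ _
  have hbP : b ∈ P := (Finset.mem_filter.1 hbS).1
  have hab : a < b := (Finset.mem_filter.1 hbS).2
  have hbmin : ∀ p ∈ P, a < p → b ≤ p := fun p hp h => Finset.min'_le _ _ (Finset.mem_filter.2 ⟨hp, h⟩)
  -- `f(b) ≤ a < b ≤ f(a)`
  have hfb : f b ≤ a := by
    by_contra h
    push Not at h
    have hbfb : f b < b := lt_of_le_of_ne
      (not_lt.1 fun hlt => absurd hab (not_lt.2 (hamax b hbP hlt))) (hPfix b hbP).1
    exact absurd hbfb (not_lt.2 (hbmin _ (hPf b hbP) h))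
  have hbfa : b ≤ f a := hbmin _ (hPf a haP) hafa
  -- `v ∈ [a, b]` with `f v = b`
  have hIab : Icc a b ⊆ Icc A B := Icc_subset_Icc (hPab a haP).1 (hPab b hbP).2
  obtain ⟨v, ⟨hav, hvb⟩, hfv⟩ :=
    intermediate_value_Icc' hab.le (hf.mono hIab) ⟨hfb.trans hab.le, hbfa⟩
  have hvb' : v < b := lt_of_le_of_ne hvb fun h => (hPfix b hbP).1 (by rw [← h, hfv, h])
  have hffv : f (f v) < v := by
    rw [hfv]
    rcases (hfb.trans hav).lt_or_eq with h | h
    · exact h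
    · -- `f b = v` forces `v = a`, `f a = b`, `f b = a`: a period-2 point in `P`, impossible.
      exfalso
      have hva : v = a := le_antisymm (h ▸ hfb) hav
      refine (hPfix a haP).2 ?_
      rw [← hva, hfv, h]
  refine ⟨v, pm, hIab ⟨hav, hvb⟩, hPab pm hpmP, hffv, by rw [hfv]; exact hvb', ?_, ?_, ?_⟩
  · rw [hfv, ← hPper b hbP]; exact iterate_minimalPeriod
  · rw [hfv]; exact hpmle _ (hPf b hbP)
  · exact lt_of_le_of_ne (hpmle _ (hPf _ (hPf _ hpmP))) (hPfix pm hpmP).2.symm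

/-! ## §3 The points `z`, `y` and step (a) -/

/-- **The period-`2` point `y` (Du §3, proof of (a)).** In the configuration `pm ≤ f²(v) < v < f(v)`, `f²(pm) > pm`
(`pm, v ∈ [A, B]`), let `z` be a fixed point in `(v, f(v))` and `y = max{pm ≤ x ≤ v : f²(x) = x}`. Then `y < v < z`,
`f²(y) = y`, `f²(x) < x` on `(y, v]` and `f(x) > z` on `[y, v]`; in particular `y` has least period `2`.
[cite: Du2007SharkovskyCollection, §3, proof of (a)] -/
theorem exists_period_two_point (hf : ContinuousOn f (Icc A B)) (hmaps : MapsTo f (Icc A B) (Icc A B)) {v pm : ℝ}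
    (hv : v ∈ Icc A B) (hpm : pm ∈ Icc A B) (hv1 : f (f v) < v) (hv2 : v < f v) (hpm1 : pm ≤ f (f v))
    (hpm2 : pm < f (f pm)) :
    ∃ y z, pm ≤ y ∧ y < v ∧ v < z ∧ z < f v ∧ f z = z ∧ f (f y) = y ∧
      (∀ x ∈ Ioc y v, f (f x) < x) ∧ (∀ x ∈ Icc y v, z < f x) := by
  have hg : ContinuousOn (fun x => f (f x)) (Icc A B) := hf.comp hf hmaps
  have hfv : f v ∈ Icc A B := hmaps hv
  -- `z`: a fixed point in `(v, f v)`
  have hIvz : Icc v (f v) ⊆ Icc A B := Icc_subset_Icc hv.1 hfv.2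
  obtain ⟨z, ⟨hvz, hzfv⟩, hfz⟩ :=
    exists_fixedPt_of_le_of_ge hv2.le (hf.mono hIvz) hv2.le (hv1.trans hv2).le
  have hvz' : v < z := lt_of_le_of_ne hvz fun h => hv2.ne (by rw [h, hfz])
  have hzfv' : z < f v := lt_of_le_of_ne hzfv fun h => by
    rw [h] at hfz; exact (hv1.trans hv2).ne hfz
  -- `y = max {x ∈ [pm, v] : f (f x) = x}`
  have hpmv : pm ≤ v := hpm1.trans hv1.le
  have hIpv : Icc pm v ⊆ Icc A B := Icc_subset_Icc hpm.1 hv.2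
  have hS : IsCompact {x | x ∈ Icc pm v ∧ f (f x) = x} := isCompact_eqLocus (hg.mono hIpv) continuousOn_id
  obtain ⟨w₀, hw₀, hfw₀⟩ := exists_fixedPt_of_le_of_ge hpmv (hg.mono hIpv) hpm2.le hv1.le
  obtain ⟨y, ⟨⟨hpy, hyv⟩, hfy⟩, hymax⟩ := hS.exists_isGreatest ⟨w₀, hw₀, hfw₀⟩
  have hyv' : y < v := lt_of_le_of_ne hyv fun h => hv1.ne (by rw [← h]; exact hfy)
  -- `f² x < x` on `(y, v]`
  have hlt : ∀ x ∈ Ioc y v, f (f x) < x := by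
    rintro x ⟨hyx, hxv⟩
    by_contra h
    push Not at h
    obtain ⟨w, ⟨hxw, hwv⟩, hfw⟩ :=
      exists_fixedPt_of_le_of_ge hxv (hg.mono (Icc_subset_Icc (hpy.trans hyx.le) le_rfl |>.trans hIpv)) h hv1.le
    have := hymax ⟨⟨hpy.trans (hyx.le.trans hxw), hwv⟩, hfw⟩
    exact absurd (hyx.trans_le hxw) (not_lt.2 this)
  -- `f x > z` on `[y, v]`
  have hgt : ∀ x ∈ Icc y v, z < f x := by
    rintro x ⟨hyx, hxv⟩
    by_contra h
    push Not at h
    -- a point `w ∈ [x, v]` with `f w = z`, hence `f² w = z > v ≥ w`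
    obtain ⟨w, ⟨hxw, hwv⟩, hfw⟩ :=
      intermediate_value_Icc hxv (hf.mono (Icc_subset_Icc (hpm.1.trans (hpy.trans hyx)) hv.2)) ⟨h, hzfv⟩
    have hffw : f (f w) = z := by rw [hfw, hfz]
    rcases (hyx.trans hxw).lt_or_eq with hyw | hyw
    · have := hlt w ⟨hyw, hwv⟩
      rw [hffw] at this
      exact absurd (hwv.trans_lt hvz') (lt_asymm this)
    · rw [← hyw, hfy] at hffw
      exact absurd (hyv'.trans hvz') (hffw ▸ lt_irrefl y)
  exact ⟨y, z, hpy, hyv', hvz', hzfv', hfz, hfy, hlt, hgt⟩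

/-- **Step (a) (Du).** If a continuous self-map of `[A, B]` has a point of least period `m ≥ 3`, it has a point of least
period `2`. [cite: Du2007SharkovskyCollection, §3 (a)] [cite: Du2004SharkovskySimpleProof, Theorem] -/
theorem exists_minimalPeriod_two_of_minimalPeriod_ge_three (hf : ContinuousOn f (Icc A B))
    (hmaps : MapsTo f (Icc A B) (Icc A B)) {x₀ : ℝ} (hx₀ : x₀ ∈ Icc A B) {m : ℕ} (hm : 3 ≤ m)
    (hper : minimalPeriod f x₀ = m) : ∃ y ∈ Icc A B, minimalPeriod f y = 2 := by
  obtain ⟨v, pm, hv, hpm, hv1, hv2, -, hpm1, hpm2⟩ := exists_du_configuration hf hmaps hx₀ hm hper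
  obtain ⟨y, z, hpy, hyv, hvz, -, -, hfy, -, hgt⟩ := exists_period_two_point hf hmaps hv hpm hv1 hv2 hpm1 hpm2
  refine ⟨y, ⟨hpm.1.trans hpy, hyv.le.trans hv.2⟩, minimalPeriod_eq_of_forall_iterate_ne two_pos hfy ?_⟩
  intro j hj hj2
  have hj1 : j = 1 := by omega
  subst hj1
  have := hgt y ⟨le_rfl, hyv.le⟩
  intro h
  rw [iterate_one] at h
  rw [h] at this
  exact absurd (hyv.trans hvz) (lt_asymm this)

/-- Odd iterates at a point with `f²(y) = y` equal `f(y)`. [folklore] -/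
private theorem iterate_odd_of_ff {y : ℝ} (hy : f (f y) = y) {N : ℕ} (hN : Odd N) : f^[N] y = f y := by
  obtain ⟨s, rfl⟩ := hN; exact iterate_two_mul_add_one_of_ff hy s

/-- `f^{m+2}(v) = f²(v)` and `f^{m+1}(v) = f(v)` when `f(v)` has period `m`. [folklore] -/
private theorem iterate_add_two_of_periodic {v : ℝ} {m : ℕ} (hvm : f^[m] (f v) = f v) :
    f^[m + 2] v = f (f v) ∧ f^[m + 1] v = f v := by
  constructor
  · rw [show m + 2 = m + 1 + 1 from rfl, iterate_succ_apply, iterate_succ_apply', hvm]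
  · rw [iterate_succ_apply, hvm]

/-! ## §4 Step (b): an odd period `m ≥ 3` forces period `m + 2` -/

/-- **Step (b) (Du).** If a continuous self-map of `[A, B]` has a point of least period `m ≥ 3` with `m` odd, it has a
point of least period `m + 2`: `p_{m+2} = min{y ≤ x ≤ v : f^{m+2}(x) = x}` has an odd least period `k > 1` dividing
`m + 2`, and `k < m + 2` would let the solutions `x_k > x_{k+2} > ⋯` of `f^{k+2n}(x) = x` descend below `p_{m+2}`.
[cite: Du2007SharkovskyCollection, §3 (b)] [cite: Du2004SharkovskySimpleProof, Theorem] -/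
theorem exists_minimalPeriod_add_two_of_odd (hf : ContinuousOn f (Icc A B)) (hmaps : MapsTo f (Icc A B) (Icc A B))
    {x₀ : ℝ} (hx₀ : x₀ ∈ Icc A B) {m : ℕ} (hm : 3 ≤ m) (hodd : Odd m) (hper : minimalPeriod f x₀ = m) :
    ∃ p ∈ Icc A B, minimalPeriod f p = m + 2 := by
  obtain ⟨v, pm, hv, hpm, hv1, hv2, hvm, hpm1, hpm2⟩ := exists_du_configuration hf hmaps hx₀ hm hper
  obtain ⟨y, z, hpy, hyv, hvz, -, -, hfy, hlt, hgt⟩ := exists_period_two_point hf hmaps hv hpm hv1 hv2 hpm1 hpm2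
  have hyAB : Icc y v ⊆ Icc A B := Icc_subset_Icc (hpm.1.trans hpy) hv.2
  have hfit : ∀ n, ContinuousOn f^[n] (Icc A B) := hf.iterate hmaps
  have hyfy : y < f y := (hyv.trans hvz).trans (hgt y ⟨le_rfl, hyv.le⟩)
  have hodd2 : Odd (m + 2) := hodd.add_even even_two
  have hFy : f^[m + 2] y = f y := iterate_odd_of_ff hfy hodd2
  have hFv : f^[m + 2] v = f (f v) := (iterate_add_two_of_periodic hvm).1
  -- `p = min {x ∈ [y, v] : f^{m+2} x = x}`
  have hS : IsCompact {x | x ∈ Icc y v ∧ f^[m + 2] x = x} := isCompact_eqLocus ((hfit _).mono hyAB) continuousOn_id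
  obtain ⟨w, hw, hFw⟩ :=
    exists_fixedPt_of_le_of_ge hyv.le ((hfit (m + 2)).mono hyAB) (by rw [hFy]; exact hyfy.le)
      (by rw [hFv]; exact hv1.le)
  obtain ⟨p, ⟨⟨hyp, hpv⟩, hFp⟩, hpmin⟩ := hS.exists_isLeast ⟨w, hw, hFw⟩
  have hyp' : y < p := lt_of_le_of_ne hyp fun h => hyfy.ne (by rw [← hFy, h, hFp, ← h])
  have hpv' : p < v := lt_of_le_of_ne hpv fun h => hv1.ne (by rw [← hFv, ← h, hFp])
  -- `k`, the least period of `p`: odd, `> 1`, divides `m + 2`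
  have hFp' : IsPeriodicPt f (m + 2) p := hFp
  have hkdvd : minimalPeriod f p ∣ m + 2 := hFp'.minimalPeriod_dvd
  have hkpos : 0 < minimalPeriod f p := hFp'.minimalPeriod_pos (by omega)
  have hkodd : Odd (minimalPeriod f p) := hodd2.of_dvd_nat hkdvd
  have hkle : minimalPeriod f p ≤ m + 2 := Nat.le_of_dvd (by omega) hkdvd
  have hk1 : minimalPeriod f p ≠ 1 := by
    intro h1
    have hfix : f p = p := by have := iterate_minimalPeriod (f := f) (x := p); rwa [h1, iterate_one] at this
    have := hgt p ⟨hyp, hpv⟩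
    rw [hfix] at this
    exact absurd (hpv.trans_lt hvz) (lt_asymm this)
  refine ⟨p, hyAB ⟨hyp, hpv⟩, ?_⟩
  rcases hkle.lt_or_eq with hklt | hkeq
  · exfalso
    set k := minimalPeriod f p with hk
    -- the descent `x_k = p > x_{k+2} > ⋯ > x_{k+2s}` of solutions of `f^{k+2s}(x) = x` in `(y, p]`
    have hdesc : ∀ s, ∃ x, y < x ∧ x ≤ p ∧ f^[k + 2 * s] x = x ∧ (0 < s → x < p) := by
      intro s
      induction s with
      | zero => exact ⟨p, hyp', le_rfl, by rw [Nat.mul_zero, Nat.add_zero, hk]; exact iterate_minimalPeriod,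
          fun h => absurd h (lt_irrefl 0)⟩
      | succ s ih =>
        obtain ⟨x, hyx, hxp, hFx, -⟩ := ih
        have hxAB : Icc y x ⊆ Icc A B := (Icc_subset_Icc_right (hxp.trans hpv)).trans hyAB
        have hN : Odd (k + 2 * (s + 1)) := hkodd.add_even (even_two_mul _)
        have hNy : f^[k + 2 * (s + 1)] y = f y := iterate_odd_of_ff hfy hN
        have hNx : f^[k + 2 * (s + 1)] x = f (f x) := by
          rw [show k + 2 * (s + 1) = 2 + (k + 2 * s) by ring, iterate_add_apply, hFx]; rfl
        have hffx : f (f x) < x := hlt x ⟨hyx, hxp.trans hpv⟩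
        obtain ⟨x', ⟨hyx', hx'x⟩, hFx'⟩ :=
          exists_fixedPt_of_le_of_ge hyx.le ((hfit _).mono hxAB) (by rw [hNy]; exact hyfy.le)
            (by rw [hNx]; exact hffx.le)
        have hyx'' : y < x' := lt_of_le_of_ne hyx' fun h => hyfy.ne (by rw [← hNy, h, hFx', ← h])
        have hx'x' : x' < x := lt_of_le_of_ne hx'x fun h => hffx.ne (by rw [← hNx, ← h, hFx'])
        exact ⟨x', hyx'', hx'x.trans hxp, hFx', fun _ => hx'x'.trans_le hxp⟩
    -- `m + 2 = k + 2s` with `s ≥ 1`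
    obtain ⟨a, ha⟩ := hkodd
    obtain ⟨t, ht⟩ := hodd
    obtain ⟨x, hyx, hxp, hFx, hxlt⟩ := hdesc (t + 1 - a)
    have hs : k + 2 * (t + 1 - a) = m + 2 := by omega
    rw [hs] at hFx
    have := hpmin ⟨⟨hyx.le, hxp.trans hpv⟩, hFx⟩
    exact absurd (hxlt (by omega)) (not_lt.2 this)
  · exact hkeq

/-! ## §5 Step (c): an odd period `m ≥ 3` forces every even period -/

/-- **The horseshoe for `f²` at the end of Du's proof of (c).** Suppose `A ≤ d < u < z₀ ≤ z`, `z₀ ≤ B`, `f²(d) = z₀`,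
`f²(u) = d`, `f²(z₀) = z₀` and `f(x) > z` for `d < x < z₀`. Then for every `n ≥ 1`, `f` has a point of least period `2n`
in `[A, B]`: the intervals `K₀ = [d, u]` and `K₁ = [u, z₀]` each `f²`-cover `[d, z₀]`, so (file 1) some `c ∈ K₀` has
least `f²`-period `n` with `f²`-orbit in `(d, z₀)`, and its odd iterates `f^{2i+1}(c) > z ≥ z₀ > c` rule out a smaller
`f`-period («we have `fⁱ(c_{2n}) < z₀ < fʲ(c_{2n})` for all even `i` and all odd `j`. So, each `c_{2n}` is a
period-`(2n)` point»). [cite: Du2007SharkovskyCollection, §3 (c)] -/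
theorem exists_minimalPeriod_two_mul_of_horseshoe (hf : ContinuousOn f (Icc A B))
    (hmaps : MapsTo f (Icc A B) (Icc A B)) {d u z₀ z : ℝ} (hAd : A ≤ d) (hdu : d < u) (huz₀ : u < z₀)
    (hz₀z : z₀ ≤ z) (hz₀B : z₀ ≤ B) (hgd : f (f d) = z₀) (hgu : f (f u) = d) (hgz₀ : f (f z₀) = z₀)
    (hbig : ∀ x ∈ Ioo d z₀, z < f x) {n : ℕ} (hn : 0 < n) :
    ∃ c ∈ Icc A B, minimalPeriod f c = 2 * n := by
  have hg : ContinuousOn f^[2] (Icc A B) := hf.iterate hmaps 2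
  have hgmaps : MapsTo f^[2] (Icc A B) (Icc A B) := hmaps.iterate 2
  have hgd' : f^[2] d = z₀ := hgd
  have hgu' : f^[2] u = d := hgu
  have hgz₀' : f^[2] z₀ = z₀ := hgz₀
  have hK₀ : Icc d u ⊆ Icc A B := Icc_subset_Icc hAd (huz₀.le.trans hz₀B)
  have hK₁ : Icc u z₀ ⊆ Icc A B := Icc_subset_Icc (hAd.trans hdu.le) hz₀B
  -- the coverings
  have hcov₀ : Icc d z₀ ⊆ f^[2] '' Icc d u := by
    have := intermediate_value_Icc' hdu.le (hg.mono hK₀); rwa [hgu', hgd'] at this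
  have hcov₁ : Icc d z₀ ⊆ f^[2] '' Icc u z₀ := by
    have := intermediate_value_Icc huz₀.le (hg.mono hK₁); rwa [hgu', hgz₀'] at this
  have h₀₀ : Icc d u ⊆ f^[2] '' Icc d u := (Icc_subset_Icc_right huz₀.le).trans hcov₀
  have h₀₁ : Icc u z₀ ⊆ f^[2] '' Icc d u := (Icc_subset_Icc_left hdu.le).trans hcov₀
  have h₁₀ : Icc d u ⊆ f^[2] '' Icc u z₀ := (Icc_subset_Icc_right huz₀.le).trans hcov₁
  -- `u ↦ d ↦ z₀ ↦ z₀ ↦ ⋯` is not periodic under `f²`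
  have horb : ∀ j, 2 ≤ j → (f^[2])^[j] u = z₀ := by
    intro j hj
    induction j, hj using Nat.le_induction with
    | base => rw [iterate_succ_apply', iterate_one, hgu', hgd']
    | succ j _ ih => rw [iterate_succ_apply', ih, hgz₀']
  have hu : u ∉ periodicPts f^[2] := by
    intro hu
    obtain ⟨q, hq, hqu⟩ := mem_periodicPts.1 hu
    rcases Nat.lt_or_ge q 2 with hq2 | hq2
    · have hq1 : q = 1 := by omega
      subst hq1
      have : d = u := by rw [← hgu']; exact hqu
      exact hdu.ne this
    · have : z₀ = u := by rw [← horb q hq2]; exact hqu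
      exact huz₀.ne' this
  -- a point `c ∈ K₀` of least `f²`-period `n` whose first `n` iterates lie in `K₀ ∪ K₁ = [d, z₀]`
  have hK₀' : Icc d u ⊆ Icc d z₀ := Icc_subset_Icc_right huz₀.le
  have hK₁' : Icc u z₀ ⊆ Icc d z₀ := Icc_subset_Icc_left hdu.le
  obtain ⟨c, hcK₀, hgc, hit⟩ :
      ∃ c ∈ Icc d u, minimalPeriod f^[2] c = n ∧ ∀ i < n, (f^[2])^[i] c ∈ Icc d z₀ := by
    rcases Nat.lt_or_ge n 2 with hn2 | hn2
    · have hn1 : n = 1 := by omega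
      subst hn1
      obtain ⟨c, hc, hfc⟩ := exists_fixedPt_of_Icc_subset_image hdu.le (hg.mono hK₀) h₀₀
      refine ⟨c, hc, minimalPeriod_eq_of_forall_iterate_ne one_pos (show (f^[2])^[1] c = c from hfc)
        (fun j hj hj1 => by omega), fun i hi => ?_⟩
      have hi0 : i = 0 := by omega
      subst hi0
      exact hK₀' hc
    · obtain ⟨c, hc, hgc, hit₀, hit₁⟩ :=
        exists_periodicPt_itinerary_two hg hgmaps hdu.le huz₀.le hK₀ hK₁ h₀₀ h₀₁ h₁₀ hn2
      refine ⟨c, hc, minimalPeriod_eq_of_itinerary (u := u) (by omega) ?_ hu hgc hit₀ hit₁, fun i hi => ?_⟩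
      · rintro x ⟨⟨_, hxu⟩, ⟨hux, _⟩⟩
        exact le_antisymm hxu hux
      · by_cases hi' : i + 1 < n
        · exact hK₀' (hit₀ i hi')
        · have : i = n - 1 := by omega
          subst this
          exact hK₁' hit₁
  have hcper : IsPeriodicPt f^[2] n c := hgc ▸ isPeriodicPt_minimalPeriod f^[2] c
  -- the whole `f²`-orbit of `c` lies in `[d, z₀]` …
  have hIcc : ∀ i, (f^[2])^[i] c ∈ Icc d z₀ := by
    intro i
    rw [← iterate_mod_minimalPeriod_eq, hgc]
    exact hit _ (Nat.mod_lt _ hn)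
  -- … and avoids `z₀` (a fixed point of `f²` different from `c`) and `d` (which maps to `z₀`)
  have hne_z₀ : ∀ i, (f^[2])^[i] c ≠ z₀ := by
    intro i hi
    have hall : ∀ j, i ≤ j → (f^[2])^[j] c = z₀ := by
      intro j hj
      induction j, hj using Nat.le_induction with
      | base => exact hi
      | succ j _ ih => rw [iterate_succ_apply', ih, hgz₀']
    have hc : (f^[2])^[n * (i + 1)] c = c := (hcper.mul_const (i + 1)).eq
    have hle : i ≤ n * (i + 1) := by nlinarith
    have : c = z₀ := by rw [← hc]; exact hall _ hle
    exact absurd (hcK₀.2.trans_lt huz₀) (this ▸ lt_irrefl z₀)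
  have hne_d : ∀ i, (f^[2])^[i] c ≠ d := by
    intro i hi
    exact hne_z₀ (i + 1) (by rw [iterate_succ_apply', hi, hgd'])
  have hIoo : ∀ i, (f^[2])^[i] c ∈ Ioo d z₀ := fun i =>
    ⟨lt_of_le_of_ne (hIcc i).1 (fun h => hne_d i h.symm), lt_of_le_of_ne (hIcc i).2 (hne_z₀ i)⟩
  -- least `f`-period `2n`
  refine ⟨c, hK₀ hcK₀, minimalPeriod_eq_of_forall_iterate_ne (by omega) ?_ fun j hj hj2 => ?_⟩
  · rw [iterate_mul]; exact hcper.eq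
  · rcases Nat.even_or_odd j with ⟨i, rfl⟩ | ⟨i, rfl⟩
    · -- `j = i + i`: `f^j c = (f²)^i c ≠ c` since `0 < i < n`
      intro h
      rw [← two_mul, iterate_mul] at h
      have := (show IsPeriodicPt f^[2] i c from h).minimalPeriod_le (by omega)
      rw [hgc] at this
      omega
    · -- `j = 2i + 1`: `f^j c = f((f²)^i c) > z ≥ z₀ > c`
      intro h
      rw [show 2 * i + 1 = 1 + 2 * i by ring, iterate_add_apply, iterate_one, iterate_mul] at h
      have hgt := hbig _ (hIoo i)
      rw [h] at hgt
      exact absurd ((hcK₀.2.trans_lt huz₀).trans_le hz₀z) (lt_asymm hgt)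

/-- **Du's `f²`-horseshoe from an odd period** (the data of step (c), isolated for reuse): if a continuous self-map
of `[A, B]` has a point of least period `m ≥ 3`, `m` odd, there are `A ≤ d < u < z₀ ≤ z`, `z₀ ≤ B`, with
`f²(d) = z₀`, `f²(u) = d`, `f²(z₀) = z₀` and `f > z` on `(d, z₀)`; so `([d, u], [u, z₀])` is a horseshoe for `f²`.
Construction as printed: `z₀ = min{v ≤ x ≤ z : f²(x) = x}`; `f²([min I, z₀]) ⊄ [min I, z₀]` because
`(f²)^{(m+1)/2}(v) = b > z₀`, whence `d = max{min I ≤ x ≤ y : f²(x) = z₀}`; `f > z ≥ z₀ > f²` on `(d, z₀)`;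
`f²([d, z₀]) ⊄ [d, z₀]` for the same reason, whence `u ∈ (d, z₀)` with `f²(u) = d`.
[cite: Du2007SharkovskyCollection, §3 (c)] [cite: Du2004SharkovskySimpleProof, Theorem] -/
theorem exists_sq_horseshoe_of_odd (hf : ContinuousOn f (Icc A B)) (hmaps : MapsTo f (Icc A B) (Icc A B))
    {x₀ : ℝ} (hx₀ : x₀ ∈ Icc A B) {m : ℕ} (hm : 3 ≤ m) (hodd : Odd m) (hper : minimalPeriod f x₀ = m) :
    ∃ d u z₀ z, A ≤ d ∧ d < u ∧ u < z₀ ∧ z₀ ≤ z ∧ z₀ ≤ B ∧ f (f d) = z₀ ∧ f (f u) = d ∧ f (f z₀) = z₀ ∧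
      ∀ x ∈ Ioo d z₀, z < f x := by
  obtain ⟨v, pm, hv, hpm, hv1, hv2, hvm, hpm1, hpm2⟩ := exists_du_configuration hf hmaps hx₀ hm hper
  obtain ⟨y, z, hpy, hyv, hvz, hzfv, hfz, hfy, hlt, hgt⟩ := exists_period_two_point hf hmaps hv hpm hv1 hv2 hpm1 hpm2
  have hg : ContinuousOn (fun x => f (f x)) (Icc A B) := hf.comp hf hmaps
  have hfvB : f v ≤ B := (hmaps hv).2
  have hzB : z ≤ B := hzfv.le.trans hfvB
  have hAy : A ≤ y := hpm.1.trans hpy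
  have hyfy : z < f y := hgt y ⟨le_rfl, hyv.le⟩
  -- the escaping orbit point: `f^{m+1}(v) = f(v) > z`
  obtain ⟨t, ht⟩ := hodd
  have hescape : f^[2 * (t + 1)] v = f v := by
    rw [show 2 * (t + 1) = m + 1 by omega]; exact (iterate_add_two_of_periodic hvm).2
  -- `z₀ = min {x ∈ [v, z] : f² x = x}`
  have hIvz : Icc v z ⊆ Icc A B := Icc_subset_Icc hv.1 hzB
  have hS₀ : IsCompact {x | x ∈ Icc v z ∧ f (f x) = x} := isCompact_eqLocus (hg.mono hIvz) continuousOn_id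
  obtain ⟨z₀, ⟨⟨hvz₀, hz₀z⟩, hgz₀⟩, hz₀min⟩ :=
    hS₀.exists_isLeast ⟨z, ⟨hvz.le, le_rfl⟩, by rw [hfz, hfz]⟩
  have hvz₀' : v < z₀ := lt_of_le_of_ne hvz₀ fun h => hv1.ne (by rw [h]; exact hgz₀)
  have hz₀B : z₀ ≤ B := hz₀z.trans hzB
  -- `f² x < x` on `[v, z₀)` and `f x > z` on `[v, z₀)`
  have hlt2 : ∀ x ∈ Ico v z₀, f (f x) < x := by
    rintro x ⟨hvx, hxz₀⟩
    by_contra h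
    push Not at h
    obtain ⟨w, ⟨hvw, hwx⟩, hgw⟩ :=
      exists_fixedPt_of_ge_of_le hvx (hg.mono ((Icc_subset_Icc_right (hxz₀.le.trans hz₀z)).trans hIvz)) hv1.le h
    have := hz₀min ⟨⟨hvw, hwx.trans (hxz₀.le.trans hz₀z)⟩, hgw⟩
    exact absurd (hwx.trans_lt hxz₀) (not_lt.2 this)
  have hgt2 : ∀ x ∈ Ico v z₀, z < f x := by
    rintro x ⟨hvx, hxz₀⟩
    by_contra h
    push Not at h
    obtain ⟨w, ⟨hvw, hwx⟩, hfw⟩ :=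
      intermediate_value_Icc' hvx (hf.mono ((Icc_subset_Icc_right (hxz₀.le.trans hz₀z)).trans hIvz)) ⟨h, hzfv.le⟩
    have hffw : f (f w) = z := by rw [hfw, hfz]
    have := hlt2 w ⟨hvw, hwx.trans_lt hxz₀⟩
    rw [hffw] at this
    exact absurd ((hwx.trans_lt hxz₀).trans_le hz₀z) (lt_asymm this)
  -- on `(y, z₀)`: `f² x < x`; on `[y, z₀)`: `f x > z`
  have hlt' : ∀ x ∈ Ioo y z₀, f (f x) < x := fun x hx =>
    (le_total x v).elim (fun h => hlt x ⟨hx.1, h⟩) fun h => hlt2 x ⟨h, hx.2⟩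
  have hgt' : ∀ x ∈ Ico y z₀, z < f x := fun x hx =>
    (le_total x v).elim (fun h => hgt x ⟨hx.1, h⟩) fun h => hgt2 x ⟨h, hx.2⟩
  -- escape 1: some `x₁ ∈ [A, z₀)` has `f² x₁ ≥ z₀`
  have hesc₁ : ∃ x₁ ∈ Ico A z₀, z₀ ≤ f (f x₁) := by
    by_contra h
    push Not at h
    have hinv : MapsTo (fun x => f (f x)) (Icc A z₀) (Icc A z₀) := by
      rintro x ⟨hAx, hxz₀⟩
      refine ⟨(hmaps (hmaps ⟨hAx, hxz₀.trans hz₀B⟩)).1, ?_⟩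
      rcases hxz₀.lt_or_eq with hlt₀ | rfl
      · exact (h x ⟨hAx, hlt₀⟩).le
      · exact hgz₀.le
    have := iterate_ff_mem_of_mapsTo hinv ⟨hv.1, hvz₀'.le⟩ (t + 1)
    rw [hescape] at this
    exact absurd (this.2.trans hz₀z) (not_le.2 hzfv)
  obtain ⟨x₁, ⟨hAx₁, hx₁z₀⟩, hgx₁⟩ := hesc₁
  have hx₁y : x₁ < y := by
    by_contra h
    push Not at h
    rcases h.lt_or_eq with hyx₁ | hyx₁
    · exact absurd ((hlt' x₁ ⟨hyx₁, hx₁z₀⟩).trans hx₁z₀) (not_lt.2 hgx₁)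
    · rw [← hyx₁, hfy] at hgx₁
      exact absurd (hyv.trans hvz₀') (not_lt.2 hgx₁)
  -- `d = max {x ∈ [A, y] : f² x = z₀}`
  have hIAy : Icc A y ⊆ Icc A B := Icc_subset_Icc_right (hyv.le.trans hv.2)
  have hSd : IsCompact {x | x ∈ Icc A y ∧ f (f x) = z₀} := isCompact_eqLocus (hg.mono hIAy) continuousOn_const
  obtain ⟨t₁, ⟨hx₁t₁, ht₁y⟩, hgt₁⟩ :=
    intermediate_value_Icc' hx₁y.le (hg.mono ((Icc_subset_Icc_left hAx₁).trans hIAy))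
      ⟨by rw [hfy]; exact (hyv.trans hvz₀').le, hgx₁⟩
  obtain ⟨d, ⟨⟨hAd, hdy⟩, hgd⟩, hdmax⟩ := hSd.exists_isGreatest ⟨t₁, ⟨hAx₁.trans hx₁t₁, ht₁y⟩, hgt₁⟩
  have hdy' : d < y := lt_of_le_of_ne hdy fun h => (hyv.trans hvz₀').ne (by rw [← hfy, ← h, hgd])
  -- `f² x < z₀` on `(d, y]`, `f x > z` on `(d, y)`
  have hz₀lt : ∀ x ∈ Ioc d y, f (f x) < z₀ := by
    rintro x ⟨hdx, hxy⟩
    by_contra h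
    push Not at h
    have hxy' : x < y := lt_of_le_of_ne hxy fun h' => by
      rw [h', hfy] at h; exact absurd (hyv.trans hvz₀') (not_lt.2 h)
    obtain ⟨t₂, ⟨hxt₂, ht₂y⟩, hgt₂⟩ :=
      intermediate_value_Icc' hxy'.le (hg.mono ((Icc_subset_Icc_left (hAd.trans hdx.le)).trans hIAy))
        ⟨by rw [hfy]; exact (hyv.trans hvz₀').le, h⟩
    have := hdmax ⟨⟨hAd.trans (hdx.le.trans hxt₂), ht₂y⟩, hgt₂⟩
    exact absurd (hdx.trans_le hxt₂) (not_lt.2 this)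
  have hgt3 : ∀ x ∈ Ioo d y, z < f x := by
    rintro x ⟨hdx, hxy⟩
    by_contra h
    push Not at h
    obtain ⟨w, ⟨hxw, hwy⟩, hfw⟩ :=
      intermediate_value_Icc hxy.le (hf.mono ((Icc_subset_Icc_left (hAd.trans hdx.le)).trans hIAy)) ⟨h, hyfy.le⟩
    have hffw : f (f w) = z := by rw [hfw, hfz]
    have := hz₀lt w ⟨hdx.trans_le hxw, hwy⟩
    rw [hffw] at this
    exact absurd hz₀z (not_le.2 this)
  -- on `(d, z₀)`: `f x > z` and `f² x < z₀`
  have HGT : ∀ x ∈ Ioo d z₀, z < f x := fun x hx =>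
    (lt_or_ge x y).elim (fun h => hgt3 x ⟨hx.1, h⟩) fun h => hgt' x ⟨h, hx.2⟩
  have HLT : ∀ x ∈ Ioo d z₀, f (f x) < z₀ := fun x hx =>
    (le_or_gt x y).elim (fun h => hz₀lt x ⟨hx.1, h⟩) fun h => (hlt' x ⟨h, hx.2⟩).trans hx.2
  -- escape 2: some `x₂ ∈ [d, z₀]` has `f² x₂ < d`
  have hdv : d < v := hdy'.trans hyv
  have hesc₂ : ∃ x₂ ∈ Icc d z₀, f (f x₂) < d := by
    by_contra h
    push Not at h
    have hinv : MapsTo (fun x => f (f x)) (Icc d z₀) (Icc d z₀) := by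
      rintro x ⟨hdx, hxz₀⟩
      refine ⟨h x ⟨hdx, hxz₀⟩, ?_⟩
      rcases hdx.lt_or_eq with hdx' | rfl
      · rcases hxz₀.lt_or_eq with hxz₀' | rfl
        · exact (HLT x ⟨hdx', hxz₀'⟩).le
        · exact hgz₀.le
      · exact hgd.le
    have := iterate_ff_mem_of_mapsTo hinv ⟨hdv.le, hvz₀'.le⟩ (t + 1)
    rw [hescape] at this
    exact absurd (this.2.trans hz₀z) (not_le.2 hzfv)
  obtain ⟨x₂, ⟨hdx₂, hx₂z₀⟩, hgx₂⟩ := hesc₂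
  -- `u ∈ (d, z₀)` with `f² u = d`
  have hIdz₀ : Icc d z₀ ⊆ Icc A B := Icc_subset_Icc hAd hz₀B
  obtain ⟨u, ⟨hdu, hux₂⟩, hgu⟩ :=
    intermediate_value_Icc' hdx₂ (hg.mono ((Icc_subset_Icc_right hx₂z₀).trans hIdz₀))
      ⟨hgx₂.le, by rw [hgd]; exact (hdy'.trans (hyv.trans hvz₀')).le⟩
  have hgu : f (f u) = d := hgu
  have hdu' : d < u := lt_of_le_of_ne hdu fun h => by
    rw [← h, hgd] at hgu; exact (hdy'.trans (hyv.trans hvz₀')).ne' hgu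
  have huz₀ : u < z₀ := lt_of_le_of_ne (hux₂.trans hx₂z₀) fun h => by
    rw [h, hgz₀] at hgu; exact (hdy'.trans (hyv.trans hvz₀')).ne' hgu
  exact ⟨d, u, z₀, z, hAd, hdu', huz₀, hz₀z, hz₀B, hgd, hgu, hgz₀, HGT⟩

/-- **Step (c) (Du).** If a continuous self-map of `[A, B]` has a point of least period `m ≥ 3` with `m` odd, it has
points of every even least period `2n`, `n ≥ 1` (in particular Du's «period-`6` point and a period-`(2m)` point»).
Construction as printed: `z₀ = min{v ≤ x ≤ z : f²(x) = x}`; `f²([min I, z₀]) ⊄ [min I, z₀]` because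
`(f²)^{(m+1)/2}(v) = b > z₀`, whence `d = max{min I ≤ x ≤ y : f²(x) = z₀}`; `f > z ≥ z₀ > f²` on `(d, z₀)`;
`f²([d, z₀]) ⊄ [d, z₀]` for the same reason, whence `u ∈ (d, z₀)` with `f²(u) = d`; then the `f²`-horseshoe
`[d, u], [u, z₀]` (previous theorem). [cite: Du2007SharkovskyCollection, §3 (c)] [cite: Du2004SharkovskySimpleProof, Theorem] -/
theorem exists_minimalPeriod_two_mul_of_odd (hf : ContinuousOn f (Icc A B)) (hmaps : MapsTo f (Icc A B) (Icc A B))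
    {x₀ : ℝ} (hx₀ : x₀ ∈ Icc A B) {m : ℕ} (hm : 3 ≤ m) (hodd : Odd m) (hper : minimalPeriod f x₀ = m)
    {n : ℕ} (hn : 0 < n) : ∃ c ∈ Icc A B, minimalPeriod f c = 2 * n := by
  obtain ⟨d, u, z₀, z, hAd, hdu, huz₀, hz₀z, hz₀B, hgd, hgu, hgz₀, hbig⟩ :=
    exists_sq_horseshoe_of_odd hf hmaps hx₀ hm hodd hper
  exact exists_minimalPeriod_two_mul_of_horseshoe hf hmaps hAd hdu huz₀ hz₀z hz₀B hgd hgu hgz₀ hbig hn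

/-- Steps (b) and (c) as Du states (c): an odd period `m ≥ 3` forces a period-`6` point and a period-`2m` point.
[cite: Du2007SharkovskyCollection, §1 (c) and §3 (c)] -/
theorem exists_minimalPeriod_six_and_two_mul_of_odd (hf : ContinuousOn f (Icc A B))
    (hmaps : MapsTo f (Icc A B) (Icc A B)) {x₀ : ℝ} (hx₀ : x₀ ∈ Icc A B) {m : ℕ} (hm : 3 ≤ m) (hodd : Odd m)
    (hper : minimalPeriod f x₀ = m) :
    (∃ c ∈ Icc A B, minimalPeriod f c = 6) ∧ ∃ c ∈ Icc A B, minimalPeriod f c = 2 * m :=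
  ⟨exists_minimalPeriod_two_mul_of_odd hf hmaps hx₀ hm hodd hper (n := 3) (by norm_num),
    exists_minimalPeriod_two_mul_of_odd hf hmaps hx₀ hm hodd hper (by omega)⟩

end Literature.Dynamics.IntervalMaps
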